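import Summits.KontsevichZagierPeriods.KontsevichZagierPeriods.Theses.SphericalSchlafli
import Summits.KontsevichZagierPeriods.KontsevichZagierPeriods.Theorems.InverseLandauTateLiftingRationalAngleSquares

/-!
# `RationalAngleSquares` (stmt-KontsevichZagierPeriods-3820, route SphericalSchlafli) — proof

Squares of rational angles are accessible multiples of `[π]·[π]`: for `0 < m < n` and
`T = tan(mπ/2n)`, every representation `[[0,T]², 4/((1+x²)(1+y²))]` (value `(mπ/n)²`) and every
integrand-`1` representation of the bidisc `D̄ × D̄ ⊆ ℝ⁴` (value `π²`) satisfy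
`n² • [square] − m² • [bidisc] ∈ KZ.relations`. This is verbatim the statement proved as
`Summit.KontsevichZagierPeriods.InverseLandau.tateLifting_rationalAngleSquares` (stub
`stub_rationalAngleSquares` of line `Sketch` of crux `TateLifting`, lead c10), via the formal period
ring and the dimension-one rational kernel theorem `kzKernelConjecture_lowDimAlg`.
-/

namespace Summit.KontsevichZagierPeriods.SphericalSchlafli

/-- **`RationalAngleSquares`** (route SphericalSchlafli, stmt-KontsevichZagierPeriods-3820): for
`0 < m < n`, `n² • [[0,tan(mπ/2n)]², 4/((1+x²)(1+y²))] − m² • [D̄ × D̄, 1] ∈ KZ.relations`.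
Proof: `InverseLandau.tateLifting_rationalAngleSquares`. [cite: KontsevichZagier2001, §1.2] -/
theorem rationalAngleSquares_proof :
    Summit.KontsevichZagierPeriods.KontsevichZagierPeriods.Theses.SphericalSchlafli.RationalAngleSquares :=
  Summit.KontsevichZagierPeriods.InverseLandau.tateLifting_rationalAngleSquares

end Summit.KontsevichZagierPeriods.SphericalSchlafli
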